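import Summits.Ventures.CertifiedArithmetic.LowPrec.GemmFirstRegimeGrid
import HarnessLib

/-!
# GEMM worst case LXII-b — ENTRY WORDS on a dyadic grid, every precision: attainment of the
# restart bound `W_p(n₀+k) = ku/(1+ku)`, the plateau, the late and the deficient entry

HONEST FRAMING: certified error envelopes and provably optimal rounding/accumulation schemes for
low-precision formats under stated cost models; every table by two implementations; no hardware or
vendor claims.

Continues file LXII-a (`GemmFirstRegimeGrid`: grid `2^-G`, letters `|z| ≤ M`, odd letters `≤ m₀`,
`T = 2^(manBits+1)`, `n₀ = j₀ + 1` with `M j₀ + m₀ < T`; the exact range and the restart bound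
`R(x, n₀+k) ≤ k/(T+k)`).  File LXI-b did this for E2M1² with TWO free letters; the FP6 alphabets need
THREE (E3M2² into binary32 enters the binade `[2^24, 2^25)` at `2^24 + 1 = 172032 + 147456 + 1 +
200704·82` and no two letters do it), so the entry word here is, in grid units,
`A, B, M^{×j}, C, 1, 1, …` (`ewN3`; `j + 2 = n₀` letters before the entry letter `C`):

* `roundNE_tie_downG` — THE ONE ROUNDING FACT: for `T ≤ V₀ < 2T` with `4 ∣ V₀` (an even significand
  on the binade of spacing `2`), `fl_φ((V₀+1)/2^G) = V₀/2^G` (ties-to-even drops the unit above).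
* `ew3_seqSum`, `relErr_entryWord3` — if `V = A + B + Mj + C ∈ {V₀, V₀+1}` then from the entry on the
  accumulator holds `V₀/2^G` for ever (every later unit is a dropped tie), so the relative error after
  `j + 3 + d` letters is exactly `(V + d - V₀)/(V + d)`.
* `relErr_ew3_deficient` (`V = T + 4e + 1`: error `(d+1)/(T + 4e + d + 1)`; `e = 0` is ATTAINMENT of
  Lange–Rump's bound `k/(T+k)` at `n₀ + k` letters, `relErr_ew3_law`), `relErr_ew3_late` (`V = T`:
  `d/(T+d)`, one letter late), `relErr_ew3_plateau` (`M^{×n₀}, 1, 1, …` with `T ≤ M n₀`: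
  `(d+1)/(M n₀ + d + 1)`, so the zero range `n ≤ n₀` of file LXII-a is sharp).
File LXII-c turns these into rows of `W_φ` for the six alphabets (which of `T + 1`, `T`, `T + 4e + 1`
are sums `A + B + Mj + C` of letters is a finite question per `p mod ord_{M'}(2)`, `M = 2^v M'`).

Method: the precision and the alphabet are symbols; one application of the binade step
`rneSigMag_binade_step` of file XLIX-a through the grid bridge `toRat_roundNE_grid_prec`.
References: [BoldoEtAl2023, Thm 4.5] (bound `ku/(1+ku)` attained by `(1,u,…,u)`; here by letters),
[LangeRump2019]; [IEEE7542019, §4.3.1] (ties to even); [Higham2002, §4.2]; [RouhaniEtAl2023MX,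
Table 1]; FRESHNESS-GEMM.md gen 16 (novelty presearch).
-/

namespace Summit.Ventures.CertifiedArithmetic.LowPrec.Gemm

open Literature.ComputerArithmetic.FloatingPoint
open Literature.ComputerArithmetic.FloatingPoint.MiniFloat
open Finset

/-! ### Entry words `A, B, M^{×j}, C, 1, 1, …` in grid units -/

/-- The entry word in grid units: `A, B, M^{×j}, C, 1, 1, …`. [cell, gemm.tex Prop. p:fpA (iii)] -/
def ewN3 (M j A B C : ℕ) (i : ℕ) : ℕ :=
  if i = 0 then A else if i = 1 then B else if i ≤ j + 1 then M else if i = j + 2 then C else 1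

/-- The entry word in value units (grid `2^-G`). [cell] -/
def ew3 (G M j A B C : ℕ) : ℕ → ℚ := fun i => (ewN3 M j A B C i : ℚ) / 2 ^ G

variable {G M m0 j A B C : ℕ}

/-- Letter `0` is `A`. [cell] -/
theorem ewN3_zero : ewN3 M j A B C 0 = A := by unfold ewN3; rw [if_pos rfl]

/-- Letter `1` is `B`. [cell] -/
theorem ewN3_one : ewN3 M j A B C 1 = B := by unfold ewN3; rw [if_neg one_ne_zero, if_pos rfl]

/-- Letters `2 … j+1` are `M`. [cell] -/
theorem ewN3_mid {i : ℕ} (h2 : 2 ≤ i) (h : i ≤ j + 1) : ewN3 M j A B C i = M := by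
  unfold ewN3; rw [if_neg (by omega), if_neg (by omega), if_pos h]

/-- Letter `j+2` (the entry letter) is `C`. [cell] -/
theorem ewN3_entry : ewN3 M j A B C (j + 2) = C := by
  unfold ewN3; rw [if_neg (by omega), if_neg (by omega), if_neg (by omega), if_pos rfl]

/-- Letters after `j+2` are `1`. [cell] -/
theorem ewN3_tail {i : ℕ} (h : j + 2 < i) : ewN3 M j A B C i = 1 := by
  unfold ewN3; rw [if_neg (by omega), if_neg (by omega), if_neg (by omega), if_neg (by omega)]

/-- Every letter of the word satisfies a property that `A, B, M, C, 1` satisfy. [cell] -/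
theorem ewN3_forall {P : ℕ → Prop} (hA : P A) (hB : P B) (hM : P M) (hC : P C) (h1 : P 1)
    (i : ℕ) : P (ewN3 M j A B C i) := by
  unfold ewN3; split_ifs <;> assumption

/-- … in value units: a property of `A/2^G, B/2^G, M/2^G, C/2^G, 1/2^G` holds for every letter
(used with `P = (· ∈ Π)` per alphabet). [cell] -/
theorem ew3_forall {P : ℚ → Prop} (hA : P ((A : ℚ) / 2 ^ G)) (hB : P ((B : ℚ) / 2 ^ G))
    (hM : P ((M : ℚ) / 2 ^ G)) (hC : P ((C : ℚ) / 2 ^ G)) (h1 : P (1 / 2 ^ G)) (i : ℕ) :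
    P (ew3 G M j A B C i) := by
  unfold ew3
  have h1' : P (((1 : ℕ) : ℚ) / 2 ^ G) := by simpa using h1
  exact ewN3_forall (P := fun n : ℕ => P ((n : ℚ) / 2 ^ G)) hA hB hM hC h1' i

/-- The word is a word over the grid alphabet `(G, M, m₀)` when `A, B, C` are letters, `M` is even
and `1 ≤ m₀ ≤ M`. [cell] -/
theorem ew3_facts (hA : A ≤ M ∧ (A % 2 = 0 ∨ A ≤ m0)) (hB : B ≤ M ∧ (B % 2 = 0 ∨ B ≤ m0))
    (hC : C ≤ M ∧ (C % 2 = 0 ∨ C ≤ m0)) (hMev : M % 2 = 0) (hm0 : 1 ≤ m0) (hm0M : m0 ≤ M) (i : ℕ) :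
    ∃ z : ℤ, ew3 G M j A B C i = (z : ℚ) / 2 ^ G ∧ z.natAbs ≤ M ∧ (z % 2 = 0 ∨ z.natAbs ≤ m0) := by
  refine ⟨(ewN3 M j A B C i : ℕ), by unfold ew3; push_cast; rfl, ?_, ?_⟩
  · rw [Int.natAbs_natCast]
    exact ewN3_forall (P := fun n => n ≤ M) hA.1 hB.1 le_rfl hC.1 (le_trans hm0 hm0M) i
  · have h := ewN3_forall (M := M) (j := j) (A := A) (B := B) (C := C)
      (P := fun n : ℕ => n % 2 = 0 ∨ n ≤ m0) hA.2 hB.2 (Or.inl hMev) hC.2 (Or.inr hm0) i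
    rw [Int.natAbs_natCast]
    rcases h with h | h
    · left; omega
    · exact Or.inr h

/-- A natural letter's facts from the alphabet's integer facts. [cell] -/
theorem facts_nat_of {A : ℕ}
    (h : ∃ z : ℤ, ((A : ℕ) : ℚ) / 2 ^ G = (z : ℚ) / 2 ^ G ∧ z.natAbs ≤ M ∧ (z % 2 = 0 ∨ z.natAbs ≤ m0)) :
    A ≤ M ∧ (A % 2 = 0 ∨ A ≤ m0) := by
  obtain ⟨z, hz, hM, hpar⟩ := h
  have hzA : z = A := by
    have := (div_left_inj' (by positivity : (2 : ℚ) ^ G ≠ 0)).mp hz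
    exact_mod_cast this.symm
  subst hzA
  rw [Int.natAbs_natCast] at hM hpar
  refine ⟨hM, ?_⟩
  rcases hpar with h | h
  · left; omega
  · exact Or.inr h

/-- Mass of the entry word: `Σ_{i ≤ j+2+d} ewN3 i = A + B + Mj + C + d`. [cell] -/
theorem ewN3_mass : ∀ d : ℕ, ∑ i ∈ range (j + 2 + d + 1), ewN3 M j A B C i = A + B + M * j + C + d
  | 0 => by
      have h : ∑ i ∈ range j, ewN3 M j A B C (i + 1 + 1) = ∑ _i ∈ range j, M :=
        sum_congr rfl fun i hi => ewN3_mid (by omega) (by have := mem_range.mp hi; omega)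
      rw [show j + 2 + 0 + 1 = (j + 1 + 1) + 1 by ring, sum_range_succ, sum_range_succ',
        sum_range_succ', ewN3_zero, Nat.zero_add, ewN3_one, h, sum_const, card_range, smul_eq_mul,
        show j + 1 + 1 = j + 2 by ring, ewN3_entry]
      ring
  | d + 1 => by
      rw [show j + 2 + (d + 1) + 1 = (j + 2 + d + 1) + 1 by ring, sum_range_succ, ewN3_mass d,
        ewN3_tail (by omega)]
      ring

/-- … in value units. [cell] -/
theorem ew3_mass (d : ℕ) :
    ∑ i ∈ range (j + 2 + d + 1), ew3 G M j A B C i = ((A + B + M * j + C + d : ℕ) : ℚ) / 2 ^ G := by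
  unfold ew3
  simp only [div_eq_mul_inv]
  rw [← Finset.sum_mul, ← Nat.cast_sum, ewN3_mass]

/-- … and the mass of moduli is the same (all letters are nonnegative). [cell] -/
theorem ew3_absMass (d : ℕ) : ∑ i ∈ range (j + 2 + d + 1), |ew3 G M j A B C i|
    = ((A + B + M * j + C + d : ℕ) : ℚ) / 2 ^ G := by
  rw [← ew3_mass]
  exact sum_congr rfl fun i _ => abs_of_nonneg (by unfold ew3; positivity)

/-! ### The single tie `V₀ + 1 ↦ V₀` and the trajectory of an entry word -/

variable {φ : Format} {E : ℕ}

section Regime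

variable (hq : φ.qexp ≤ -(G : ℤ)) (hR : (2 : ℚ) ^ (φ.manBits + E + 3) ≤ φ.maxRat)
include hq hR

/-- THE TIE, every precision and every grid: for `T ≤ V₀ < 2T` with `4 ∣ V₀` (an even significand on
the binade of spacing `2` in grid units), `fl_φ((V₀+1)/2^G) = V₀/2^G` — the unit above is a midpoint
and ties-to-even drops it. [cite: IEEE7542019, §4.3.1; via `rneSigMag_binade_step`] -/
theorem roundNE_tie_downG {V0 : ℕ} (hT : 2 ^ (φ.manBits + 1) ≤ V0) (h2 : V0 < 2 ^ (φ.manBits + 2))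
    (h4 : 4 ∣ V0) : (roundNE φ (((V0 + 1 : ℕ) : ℚ) / 2 ^ G)).toRat = (V0 : ℚ) / 2 ^ G := by
  obtain ⟨c, hc⟩ := h4
  have hM1 : 2 ^ (φ.manBits + 1) = 2 * 2 ^ φ.manBits := by ring
  have hM2 : 2 ^ (φ.manBits + 2) = 4 * 2 ^ φ.manBits := by ring
  have hmb : 1 ≤ φ.manBits := by
    by_contra h0
    have h0' : φ.manBits = 0 := by omega
    rw [h0'] at hT h2
    norm_num at hT h2
    omega
  obtain ⟨e, he⟩ : ∃ e, 2 ^ φ.manBits = 2 * e :=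
    ⟨2 ^ (φ.manBits - 1), by rw [← pow_succ', Nat.sub_add_cancel hmb]⟩
  -- the bridge
  have hR' : (2 : ℚ) ^ (φ.manBits + (E + 3)) ≤ φ.maxRat := by rwa [← add_assoc]
  have hK : (((V0 + 1 : ℕ) : ℤ)).natAbs < 2 ^ (φ.manBits + (E + 3) + G) := by
    rw [Int.natAbs_natCast]
    have : 2 ^ (φ.manBits + 2) ≤ 2 ^ (φ.manBits + (E + 3) + G) :=
      Nat.pow_le_pow_right (by norm_num) (by omega)
    omega
  have hbr := toRat_roundNE_grid_prec hq (((V0 + 1 : ℕ) : ℤ)) (grid_le_maxRat_of_lt hR' hK)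
  rw [Int.cast_natCast, rneZ_natCast, Int.cast_natCast] at hbr
  rw [hbr]
  -- the binade step at the single tie
  have ht : 2 * c - 2 ^ φ.manBits < 2 ^ φ.manBits := by omega
  have key := rneSigMag_binade_step (m := φ.manBits) (j := 0) (r := 1) (u := 2) rfl ⟨e, he⟩
    (by norm_num) ht (by norm_num)
  have e1 : (2 ^ φ.manBits + (2 * c - 2 ^ φ.manBits)) * 2 + 1 = V0 + 1 := by omega
  have e2 : stepUp (2 * c - 2 ^ φ.manBits) 1 2 = 0 := by
    unfold stepUp; rw [if_neg (by norm_num), if_neg (by norm_num)]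
    omega
  rw [e1, e2] at key
  rw [key]
  congr 1
  have : (2 ^ φ.manBits + (2 * c - 2 ^ φ.manBits) + 0) * 2 = V0 := by omega
  exact_mod_cast this

variable (hm0M : m0 ≤ M) (hMT : M ≤ 2 ^ (φ.manBits + 1)) (hm0 : 1 ≤ m0) (hMev : M % 2 = 0)
include hm0M hMT hm0 hMev

/-- TRAJECTORY OF AN ENTRY WORD: if `A, B, C` are letters, `M(j+1) + m₀ < T` (so `n₀ ≥ j + 2`) and
`V = A + B + Mj + C ∈ {V₀, V₀+1}` with `T ≤ V₀ < 2T`, `4 ∣ V₀`, then after the entry letter `C` and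
ever after the accumulator holds `V₀/2^G`. [cell, gemm.tex Prop. p:fpA (iii)] -/
theorem ew3_seqSum {V0 : ℕ} (hA : A ≤ M ∧ (A % 2 = 0 ∨ A ≤ m0)) (hB : B ≤ M ∧ (B % 2 = 0 ∨ B ≤ m0))
    (hC : C ≤ M ∧ (C % 2 = 0 ∨ C ≤ m0)) (hj : M * (j + 1) + m0 < 2 ^ (φ.manBits + 1))
    (hT : 2 ^ (φ.manBits + 1) ≤ V0) (h2 : V0 < 2 ^ (φ.manBits + 2)) (h4 : 4 ∣ V0)
    (hV : A + B + M * j + C = V0 ∨ A + B + M * j + C = V0 + 1) :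
    ∀ d, (seqSum φ (ew3 G M j A B C) (j + 2 + d)).toRat = (V0 : ℚ) / 2 ^ G
  | 0 => by
      have hx := ew3_facts (G := G) (j := j) hA hB hC hMev hm0 hm0M
      have hm0' := ew3_mass (G := G) (M := M) (j := j) (A := A) (B := B) (C := C) 0
      simp only [Nat.add_zero] at hm0'
      have hstep : seqSum φ (ew3 G M j A B C) (j + 2 + 0)
          = roundNE φ ((seqSum φ (ew3 G M j A B C) (j + 1)).toRat + ew3 G M j A B C (j + 2)) := rfl
      rw [hstep, seqSum_exact_prefixG hx hq hR hm0M hMT hj (j + 1) le_rfl, ← sum_range_succ,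
        show j + 1 + 1 = j + 2 + 0 by ring, hm0']
      rcases hV with hV | hV
      · rw [hV]
        have hrep := grid_repr (G := G) hq hR (K := (V0 : ℤ)) (Or.inr ⟨by omega, by omega⟩)
        push_cast at hrep
        exact toRat_roundNE_of_exists hrep
      · rw [hV]; exact roundNE_tie_downG hq hR hT h2 h4
  | d + 1 => by
      rw [show j + 2 + (d + 1) = (j + 2 + d) + 1 by ring]
      simp only [seqSum]
      rw [ew3_seqSum hA hB hC hj hT h2 h4 hV d]
      have hlet : ew3 G M j A B C (j + 2 + d + 1) = 1 / 2 ^ G := by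
        unfold ew3; rw [ewN3_tail (by omega)]; push_cast; ring
      rw [hlet, show (V0 : ℚ) / 2 ^ G + 1 / 2 ^ G = ((V0 + 1 : ℕ) : ℚ) / 2 ^ G by push_cast; ring]
      exact roundNE_tie_downG hq hR hT h2 h4

/-- RELATIVE ERROR OF AN ENTRY WORD after `j + 3 + d` letters: `(V + d - V₀)/(V + d)` exactly.
[cell, gemm.tex Prop. p:fpA (iii)] -/
theorem relErr_entryWord3 {V0 : ℕ} (hA : A ≤ M ∧ (A % 2 = 0 ∨ A ≤ m0))
    (hB : B ≤ M ∧ (B % 2 = 0 ∨ B ≤ m0)) (hC : C ≤ M ∧ (C % 2 = 0 ∨ C ≤ m0))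
    (hj : M * (j + 1) + m0 < 2 ^ (φ.manBits + 1)) (hT : 2 ^ (φ.manBits + 1) ≤ V0)
    (h2 : V0 < 2 ^ (φ.manBits + 2)) (h4 : 4 ∣ V0)
    (hV : A + B + M * j + C = V0 ∨ A + B + M * j + C = V0 + 1) (d : ℕ) :
    relErr φ (ew3 G M j A B C) (j + 2 + d)
      = (((A + B + M * j + C + d : ℕ) : ℚ) - V0) / ((A + B + M * j + C + d : ℕ) : ℚ) := by
  unfold relErr
  rw [ew3_seqSum hq hR hm0M hMT hm0 hMev hA hB hC hj hT h2 h4 hV d, ew3_mass, ew3_absMass]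
  have hle : (V0 : ℚ) ≤ ((A + B + M * j + C + d : ℕ) : ℚ) := by
    exact_mod_cast (by omega : V0 ≤ A + B + M * j + C + d)
  have hpos : (0 : ℚ) < ((A + B + M * j + C + d : ℕ) : ℚ) := by
    have : 0 < V0 := lt_of_lt_of_le (by positivity) hT
    exact_mod_cast (by omega : 0 < A + B + M * j + C + d)
  rw [abs_sub_comm,
    abs_of_nonneg (by rw [sub_nonneg]; exact div_le_div_of_nonneg_right hle (by positivity)),
    div_sub_div_same, div_div_div_cancel_right₀ (by positivity : (2 : ℚ) ^ G ≠ 0)]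

/-! ### The four shapes: deficient entry (attainment for `e = 0`), late entry, plateau -/

omit hq hR hMT hMev in
/-- A nonempty exact range forces `p ≥ 2`. [cell] -/
theorem one_le_manBits_of (hj : M * (j + 1) + m0 < 2 ^ (φ.manBits + 1)) : 1 ≤ φ.manBits := by
  by_contra h0
  have h0' : φ.manBits = 0 := by omega
  have h1 : M ≤ M * (j + 1) := Nat.le_mul_of_pos_right _ (by omega)
  have hj' : M * (j + 1) + m0 < 2 := by simpa [h0'] using hj
  omega

/-- DEFICIENT ENTRY `V = T + 4e + 1` (`4e < T`): relative error `(d+1)/(T + 4e + d + 1)` after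
`j + 3 + d` letters; `e = 0` — `T + 1` a sum of `n₀ + 1` letters — is ATTAINMENT of the restart bound.
[cell, gemm.tex Prop. p:fpA (iii)/(iv)] -/
theorem relErr_ew3_deficient {e : ℕ} (hA : A ≤ M ∧ (A % 2 = 0 ∨ A ≤ m0))
    (hB : B ≤ M ∧ (B % 2 = 0 ∨ B ≤ m0)) (hC : C ≤ M ∧ (C % 2 = 0 ∨ C ≤ m0))
    (hj : M * (j + 1) + m0 < 2 ^ (φ.manBits + 1)) (he : 4 * e < 2 ^ (φ.manBits + 1))
    (hsum : A + B + M * j + C = 2 ^ (φ.manBits + 1) + 4 * e + 1) (d : ℕ) :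
    relErr φ (ew3 G M j A B C) (j + 2 + d)
      = ((d + 1 : ℕ) : ℚ) / (2 ^ (φ.manBits + 1) + 4 * e + ((d + 1 : ℕ) : ℚ)) := by
  have hT2 : 2 ^ (φ.manBits + 2) = 2 * 2 ^ (φ.manBits + 1) := by ring
  have hmb : 1 ≤ φ.manBits := one_le_manBits_of hm0M hm0 hj
  have h4 : 4 ∣ 2 ^ (φ.manBits + 1) + 4 * e := by
    refine dvd_add ⟨2 ^ (φ.manBits - 1), ?_⟩ ⟨e, rfl⟩
    rw [show (4 : ℕ) = 2 ^ 2 by norm_num, ← pow_add]; congr 1; omega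
  have h := relErr_entryWord3 hq hR hm0M hMT hm0 hMev hA hB hC hj (V0 := 2 ^ (φ.manBits + 1) + 4 * e)
    (by omega) (by omega) h4 (Or.inr hsum) d
  rw [h, hsum]; push_cast; ring

/-- ATTAINMENT (`e = 0`): `T + 1 = A + B + Mj + C` over letters ⟹ relative error `(d+1)/(T+d+1)`
after `n₀ + 1 + d` letters, i.e. `k/(T+k) = ku/(1+ku)` at `n₀ + k` [BoldoEtAl2023, Thm 4.5: attained
by `(1,u,…,u)`; here by products]. [cell, gemm.tex Prop. p:fpA (iii)] -/
theorem relErr_ew3_law (hA : A ≤ M ∧ (A % 2 = 0 ∨ A ≤ m0)) (hB : B ≤ M ∧ (B % 2 = 0 ∨ B ≤ m0))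
    (hC : C ≤ M ∧ (C % 2 = 0 ∨ C ≤ m0)) (hj : M * (j + 1) + m0 < 2 ^ (φ.manBits + 1))
    (hsum : A + B + M * j + C = 2 ^ (φ.manBits + 1) + 1) (d : ℕ) :
    relErr φ (ew3 G M j A B C) (j + 2 + d)
      = ((d + 1 : ℕ) : ℚ) / (2 ^ (φ.manBits + 1) + ((d + 1 : ℕ) : ℚ)) := by
  have h := relErr_ew3_deficient hq hR hm0M hMT hm0 hMev (e := 0) hA hB hC hj (by positivity)
    (by simpa using hsum) d
  simpa using h

/-- LATE ENTRY `V = T`: relative error `d/(T+d)` after `n₀ + 1 + d` letters (the bound `k/(T+k)` one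
letter late: `(k-1)/(T+k-1)` at `n₀ + k`). [cell, gemm.tex Prop. p:fpA (iv)] -/
theorem relErr_ew3_late (hA : A ≤ M ∧ (A % 2 = 0 ∨ A ≤ m0)) (hB : B ≤ M ∧ (B % 2 = 0 ∨ B ≤ m0))
    (hC : C ≤ M ∧ (C % 2 = 0 ∨ C ≤ m0)) (hj : M * (j + 1) + m0 < 2 ^ (φ.manBits + 1))
    (hsum : A + B + M * j + C = 2 ^ (φ.manBits + 1)) (d : ℕ) :
    relErr φ (ew3 G M j A B C) (j + 2 + d) = (d : ℚ) / (2 ^ (φ.manBits + 1) + d) := by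
  have hT2 : 2 ^ (φ.manBits + 2) = 2 * 2 ^ (φ.manBits + 1) := by ring
  have hmb : 1 ≤ φ.manBits := one_le_manBits_of hm0M hm0 hj
  have h4 : 4 ∣ 2 ^ (φ.manBits + 1) := ⟨2 ^ (φ.manBits - 1), by
    rw [show (4 : ℕ) = 2 ^ 2 by norm_num, ← pow_add]; congr 1; omega⟩
  have hpos : 0 < 2 ^ (φ.manBits + 1) := by positivity
  have h := relErr_entryWord3 hq hR hm0M hMT hm0 hMev hA hB hC hj (V0 := 2 ^ (φ.manBits + 1))
    le_rfl (by omega) h4 (Or.inl hsum) d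
  rw [h, hsum]; push_cast; ring

/-- THE PLATEAU `M^{×n₀}, 1, 1, …` (`n₀ = j + 2`, `T ≤ M n₀`, `4 ∣ M`): relative error
`(d+1)/(M n₀ + d + 1)` after `n₀ + 1 + d` letters — `M n₀ ∈ [T, 2T)` has an even significand and every
unit is a dropped tie; in particular `W(n₀+1) > 0`: the zero range is exactly `n ≤ n₀`.
[cell, gemm.tex Prop. p:fpA (i)/(iv)] -/
theorem relErr_ew3_plateau (hj : M * (j + 1) + m0 < 2 ^ (φ.manBits + 1))
    (hT : 2 ^ (φ.manBits + 1) ≤ M * (j + 2)) (h4 : 4 ∣ M) (d : ℕ) :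
    relErr φ (ew3 G M j M M 1) (j + 2 + d)
      = ((d + 1 : ℕ) : ℚ) / ((M * (j + 2) : ℕ) + ((d + 1 : ℕ) : ℚ)) := by
  have hT2 : 2 ^ (φ.manBits + 2) = 2 * 2 ^ (φ.manBits + 1) := by ring
  have hMl : M ≤ M ∧ (M % 2 = 0 ∨ M ≤ m0) := ⟨le_rfl, Or.inl hMev⟩
  have h1l : 1 ≤ M ∧ (1 % 2 = 0 ∨ 1 ≤ m0) := ⟨le_trans hm0 hm0M, Or.inr hm0⟩
  have e1 : M * (j + 2) = M * (j + 1) + M := by ring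
  have e2 : M + M + M * j + 1 = M * (j + 2) + 1 := by ring
  have h := relErr_entryWord3 hq hR hm0M hMT hm0 hMev hMl hMl h1l hj (V0 := M * (j + 2))
    hT (by omega) (dvd_mul_of_dvd_left h4 _) (Or.inr e2) d
  rw [h, e2]; push_cast; ring

end Regime

end Summit.Ventures.CertifiedArithmetic.LowPrec.Gemm
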